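import Summits.QuantumFields.BalabanUV.T4Continuum.Support.NE9LastCouplingBridge

/-!
# NE9ChannelCouplingDeriv — the CHANNEL COUPLING MODULUS binder `hTcup` of the NE9 coupling-two-point ENDs SUPPLIED FROM A
DERIVATIVE BOUND IN THE SHIFT AMPLITUDE (skeleton `t4/b2b-balaban-t4-ne9-p1/SKELETON-NE9-P1.md` leaf A3, crew item (w5) of
`t4/T4-NE9-TRIGGER.json` c1; cell `pub-balaban`, T4-DAG §2 node U3 / §6 NE9; lineage t4-ne9-p1 = prover P1, generation 21)

HONEST FRAMING (T4-DAG PAGE 1).  Rung (B)+1 on a FIXED finite torus with `FlowStep.BetaPertH` and (B) explicit — NOT infinite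
volume, NOT a mass gap, NOT the Clay problem.  NE9 is a cell NEW ESTIMATE, NOT PRINTED, NOT discharged here: bookkeeping over the
ABSTRACT carriers of `T4OutputRate`; every analytic input is a DISPLAYED binder stated INLINE (no Prop-valued definition is introduced,
trigger condition c3).  [I] = [Balaban1987RG1], [II] = [Balaban1988RG2Cluster], [III] = [Balaban1988Convergent] are quoted for TYPES
only (ABSOLUTE RULE).  BetaPertH, (B), (B^μ) do not occur.

WHY.  The ENDs `NE9LastCouplingBridge.ne9_and_fadingMemory_of_couplingTwoPoint`, `NE9VacuumSubtractedBridge.…_vacSub`,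
`NE9BridgeSizeInduction.…_sizeInduction` display the CHANNEL COUPLING MODULUS
`hTcup : |T k g (E g) y − T k g′ (E g) y| ≤ wt k y·(qT k·|g k − g′ k|)` — the step-k channel (the localized curly bracket
{𝐄_k(U_k(exp i[g_kCB′ − …]V)) − 𝐄_k(U_k(V))} of [I] (2.12) p. 268 / [II] (1.33) p. 9) read at two COUPLING ARGUMENTS on the SAME
old terms.  In print the coupling enters the channel as the AMPLITUDE of a background shift; the old action is analytic in the
background ([III] (2.27)(ii) p. 259) and its localized pieces carry the weight of [II] Lemma 1 (1.36).  The natural printed-TYPE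
shape is therefore a DERIVATIVE bound in the shift amplitude with the (1.36) weight — Lemma 1's proof applied to the
s-derivative (PROOF-INTERIOR of Lemma 1; displayed, asserted nowhere).  THIS LEAF is the reduction: derivative bound ⇒ `hTcup` by
the mean value inequality (Mathlib `Convex.norm_image_sub_le_of_norm_hasDerivWithin_le`), exactly as the co-owner's
`NE9LastCouplingReal.lastCouplingLipschitz_of_hasDerivWithin` does for the binder (L).

WHAT IS PROVED (kernel, `[folklore]`).
§1 `channelCouplingModulus_of_hasDerivWithin` (any convex set containing the window's k-th coordinates),
   `channelCouplingModulus_of_hasDerivAt_Icc` (coordinate box), `channelCouplingModulus_of_hasDerivAt_window` (box `Icc 0 γ` for a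
   window inside `T4OutputRate.Window γ`).
DISGUISE TEST.  Last coupling only, SAME old terms, one output index: a regularity property of the LINEAR channel in its amplitude
parameter — no history, no renormalised term; not NE9.

References (TYPES only): [Balaban1987RG1] CMP 109 (1987) (2.12) p. 268, Thm 1 p. 259; [Balaban1988RG2Cluster] CMP 116 (1988)
(1.33)/(1.36) p. 9; [Balaban1988Convergent] CMP 119 (1988) (2.27)(ii) p. 259.
-/

noncomputable section

namespace Summit.QuantumFields.BalabanUV.T4Continuum.NE9ChannelCouplingDeriv

open Set
open Literature.MathematicalPhysics.QuantumFieldTheory.Balaban1983to89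
open Literature.MathematicalPhysics.QuantumFieldTheory.Balaban1983to89.T4OutputRate

variable {C : Carriers} {Bg ι : Type}

/-! ## §1 `hTcup` from a derivative bound in the shift amplitude (the displayed binder is stated INLINE) -/

/-- **CHANNEL COUPLING MODULUS FROM A DERIVATIVE BOUND (kernel; supplier of leaf A3).**  DISPLAYED binder (inline, asserted
nowhere for Bałaban's channel): for every history `g ∈ W`, step `k` and output index `y` there is ONE real function `φ` of the
amplitude with a derivative `φ′` WITHIN a CONVEX set `I ⊆ ℝ` containing the k-th coordinates of all window histories, with
`|φ′| ≤ wt k y·qT k` on `I`, and `φ (g′ k) = T k g′ (E g) y` for every `g′ ∈ W` (the channel reads the comparison history only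
through its k-th coupling — the STRUCTURE of [I] (2.12)/(2.13)).  CONCLUSION: the `hTcup` clause of the coupling-two-point ENDs.
Printed TYPE: [II] Lemma 1 (1.36) weight; [III] (2.27)(ii) analyticity in the background; no amplitude-derivative bound is printed.
[cite: Balaban1987RG1, (2.12)-(2.13) p.268; Balaban1988RG2Cluster, (1.36) p.9; Balaban1988Convergent, (2.27) p.259] -/
theorem channelCouplingModulus_of_hasDerivWithin {E : Functional C Bg} {W : Set (ℕ → ℝ)}
    {T : ℕ → (ℕ → ℝ) → (Bg → C.Dom → ℝ) → ι → ℝ} {wt : ℕ → ι → ℝ} {qT : ℕ → ℝ}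
    (hder : ∀ g ∈ W, ∀ (k : ℕ) (y : ι),
      ∃ (φ φ' : ℝ → ℝ) (I : Set ℝ), Convex ℝ I ∧ (∀ s ∈ I, HasDerivWithinAt φ (φ' s) I s) ∧
        (∀ s ∈ I, |φ' s| ≤ wt k y * qT k) ∧ (∀ g' ∈ W, g' k ∈ I) ∧ (∀ g' ∈ W, φ (g' k) = T k g' (E g) y)) :
    ∀ g ∈ W, ∀ g' ∈ W, ∀ (k : ℕ) (y : ι), |T k g (E g) y - T k g' (E g) y| ≤ wt k y * (qT k * |g k - g' k|) := by
  intro g hg g' hg' k y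
  obtain ⟨φ, φ', I, hI, hφ, hbd, hmem, hagree⟩ := hder g hg k y
  rw [← hagree g hg, ← hagree g' hg']
  have h := hI.norm_image_sub_le_of_norm_hasDerivWithin_le hφ
    (fun s hs => by rw [Real.norm_eq_abs]; exact hbd s hs) (hmem g' hg') (hmem g hg)
  rw [Real.norm_eq_abs, Real.norm_eq_abs] at h
  calc |φ (g k) - φ (g' k)| ≤ wt k y * qT k * |g k - g' k| := h
    _ = wt k y * (qT k * |g k - g' k|) := by ring

/-- **The same from `HasDerivAt` on a coordinate box** `Icc (lo k) (hi k)` containing the window's k-th coordinates. [folklore] -/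
theorem channelCouplingModulus_of_hasDerivAt_Icc {E : Functional C Bg} {W : Set (ℕ → ℝ)}
    {T : ℕ → (ℕ → ℝ) → (Bg → C.Dom → ℝ) → ι → ℝ} {wt : ℕ → ι → ℝ} {qT lo hi : ℕ → ℝ}
    (hbox : ∀ g ∈ W, ∀ k, g k ∈ Icc (lo k) (hi k))
    (hder : ∀ g ∈ W, ∀ (k : ℕ) (y : ι),
      ∃ (φ φ' : ℝ → ℝ), (∀ s ∈ Icc (lo k) (hi k), HasDerivAt φ (φ' s) s) ∧
        (∀ s ∈ Icc (lo k) (hi k), |φ' s| ≤ wt k y * qT k) ∧ (∀ g' ∈ W, φ (g' k) = T k g' (E g) y)) :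
    ∀ g ∈ W, ∀ g' ∈ W, ∀ (k : ℕ) (y : ι), |T k g (E g) y - T k g' (E g) y| ≤ wt k y * (qT k * |g k - g' k|) := by
  refine channelCouplingModulus_of_hasDerivWithin fun g hg k y => ?_
  obtain ⟨φ, φ', hφ, hbd, hagree⟩ := hder g hg k y
  exact ⟨φ, φ', Icc (lo k) (hi k), convex_Icc _ _, fun s hs => (hφ s hs).hasDerivWithinAt, hbd,
    fun g' hg' => hbox g' hg' k, hagree⟩

/-- **The same on the window's box** `Icc 0 γ` for `W ⊆ T4OutputRate.Window γ` ([I] Thm 1 p. 259 «]0, γ]»).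
[cite: Balaban1987RG1, Thm 1 p.259] -/
theorem channelCouplingModulus_of_hasDerivAt_window {E : Functional C Bg} {W : Set (ℕ → ℝ)} {γ : ℝ}
    {T : ℕ → (ℕ → ℝ) → (Bg → C.Dom → ℝ) → ι → ℝ} {wt : ℕ → ι → ℝ} {qT : ℕ → ℝ} (hW : W ⊆ Window γ)
    (hder : ∀ g ∈ W, ∀ (k : ℕ) (y : ι),
      ∃ (φ φ' : ℝ → ℝ), (∀ s ∈ Icc (0 : ℝ) γ, HasDerivAt φ (φ' s) s) ∧
        (∀ s ∈ Icc (0 : ℝ) γ, |φ' s| ≤ wt k y * qT k) ∧ (∀ g' ∈ W, φ (g' k) = T k g' (E g) y)) :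
    ∀ g ∈ W, ∀ g' ∈ W, ∀ (k : ℕ) (y : ι), |T k g (E g) y - T k g' (E g) y| ≤ wt k y * (qT k * |g k - g' k|) := by
  refine channelCouplingModulus_of_hasDerivAt_Icc (lo := fun _ => 0) (hi := fun _ => γ) (fun g hg k => ?_) hder
  have h := (mem_window.1 (hW hg)) k
  exact ⟨h.1.le, h.2⟩

end Summit.QuantumFields.BalabanUV.T4Continuum.NE9ChannelCouplingDeriv

end
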